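import Literature.MathematicalPhysics.QuantumFieldTheory.Balaban1983to89.T3RegularMinimiser
import Literature.MathematicalPhysics.QuantumFieldTheory.Balaban1983to89.T3MinimiserStabilityReduction
import HarnessLib

/-!
# `Balaban1983to89.T3RegularMinimiserReduction` — rung R3, crux K1: the layer-3 reduction of minimiser stability AT BAŁABAN'S REGULAR
# BACKGROUND — `MinimiserStabilityRegAt ⇐ regular minimisers exist ([Balaban1985Variational] Thm 1) ∧ one-step bounds along them`

Cell `ym3-torus` (HUMAN RULING D-0037, YM ladder rung R3), seat `ym3-torus-p1` gen 4; the mirror of `T3MinimiserStabilityReduction` §4–§5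
for the regular-space functional `minActionReg` of `T3RegularMinimiser` (cell record HOME/UV3-NODE.md §11.4/§11.6).  WHAT THIS IS NOT:
no estimate; the three schemas are HYPOTHESES (never asserted) — the first is the tree's reading of [Balaban1985Variational] Thm 1 in the
d = 3 family's vocabulary, the other two are the cell's INTERP / AVG-INEQ nodes restricted to regular minimisers.

* `HasRegMinimisersAt F γ b₀ p₀ m ε₀` — from some `K₀` on, for every small datum `V` on the comparison lattice, the minima of the Wilson
  action over the REGULAR fibres `fibre(V) ∩ {PlaqSmall (ε₀L^{−2(K−n)})}` of run `K` and of run `K+1` are attained: [Balaban1985Variational]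
  Thm 1 p.279 «for an arbitrary configuration V satisfying (7) with ε₁ ≤ a₁ there exists a minimal orbit in the space 𝔘_k({Ω_j}, B₃ε₁) ∩
  𝔅_k(𝔅_k, V) (8). This orbit is a unique critical orbit in the space (6) if B₃ε₁ ≤ ε₀ and ε₀ ≤ a₀» read with all `Ω_j` the whole torus
  and `ε₁ = θBal(⌊K/m⌋) → 0` (so `B₃ε₁ ≤ ε₀` for `γ ≤ γ₁(ε₀)`); PORT caveat: print is for the averaging of [Balaban1985Averaging], the
  tree's `ℰp` is (0.4) of [Balaban1987RG1] (universality asserted there, p.253–254).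
* `UpperAlongRegMinimisersAt`, `LowerAlongRegMinimisersAt` — one-step interpolation / averaging bounds along regular minimisers whose
  output is again REGULAR at the other cut-off (interpolation divides plaquette variables by ≈ L²; averaging multiplies them by ≤ C:
  [Balaban1985Averaging] Prop 2 (54)).
* `minimiserStabilityRegAt_of_eventually`, **`minimiserStabilityRegAt_of_alongRegMinimisers`**, `unitTiltAt_of_alongRegMinimisers_fluctuationReg`.

References: T. Bałaban, CMP 102 (1985) 277 [Balaban1985Variational] (Thm 1 p.279, (2)/(6) p.278); CMP 98 (1985) 17 [Balaban1985Averaging]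
(Prop 2 (54) p.48); CMP 102 (1985) 255 [Balaban1985UV3] ((41) p.266); P. Federbush, CMP 110 (1987) 293 [Federbush1987PhaseCellIII] (Thm 4.3).
-/

noncomputable section

open MeasureTheory Filter Topology
open Literature.MathematicalPhysics.QuantumFieldTheory.Balaban1983to89.T3ContinuumYM3Torus
open Literature.MathematicalPhysics.QuantumFieldTheory.Balaban1983to89.T3UnitLawDensityEML (ℰp measurableE_ℰp)
open Literature.MathematicalPhysics.QuantumFieldTheory.Balaban1983to89.T3UnitScaleTilt
open Literature.MathematicalPhysics.QuantumFieldTheory.Balaban1983to89.T3TiltDescent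
open Literature.MathematicalPhysics.QuantumFieldTheory.Balaban1983to89.T3CruxEstimates
open Literature.MathematicalPhysics.QuantumFieldTheory.Balaban1983to89.T3ConstrainedMinimiser
open Literature.MathematicalPhysics.QuantumFieldTheory.Balaban1983to89.T3DescentFibreTower
open Literature.MathematicalPhysics.QuantumFieldTheory.Balaban1983to89.T3MinimiserStabilityReduction
open Literature.MathematicalPhysics.QuantumFieldTheory.Balaban1983to89.T3RegularMinimiser
open Literature.MathematicalPhysics.QuantumFieldTheory.Balaban1983to89.Missing

namespace Literature.MathematicalPhysics.QuantumFieldTheory.Balaban1983to89.T3RegularMinimiserReduction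

/-! ## §1 A-priori bound and the «finitely many approximations are free» lemma at the regular background -/

section Eventually

variable (F : T3Family) {G : Type*} [GaugeGroup G] [MeasurableSpace G] [RegularGaugeGroup G] (ℰ : LoopAverage G)

/-- A-priori bound: `minActionReg V ≤ 2·#plaquettes` (empty regular fibre: `sInf ∅ = 0`). [cite: Balaban1985Variational, Thm 1 (8) p.279] -/
theorem minActionReg_le_two_mul_card {n K : ℕ} (h : n ≤ K) (ε₀ : ℝ) (V : GaugeField (F.P n) 0 G) :
    minActionReg F ℰ n K h ε₀ V ≤ 2 * Fintype.card (Plaq (F.P K) 0) := by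
  by_cases hV : (regFibre F ℰ n K h ε₀ V).Nonempty
  · obtain ⟨U, hU⟩ := hV
    exact (minActionReg_le F ℰ hU).trans (wilsonAction4_le_two_mul_card U)
  · have : (fun U => wilsonAction4 U) '' regFibre F ℰ n K h ε₀ V = ∅ := by
      rw [Set.image_eq_empty]; exact Set.not_nonempty_iff_eq_empty.mp hV
    unfold minActionReg
    rw [this, Real.sInf_empty]
    positivity

end Eventually

section Reduction

variable (F : T3Family) (γ b₀ p₀ : ℝ) (m : ℕ) (ε₀ : ℝ)

/-- **FINITELY MANY APPROXIMATIONS COST NOTHING** at the regular background: the inequality of `MinimiserStabilityRegAt` for `K ≥ K₀`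
with summable `r ≥ 0` suffices (`γ ≥ 0`; below `K₀` the a-priori bound `0 ≤ β·minActionReg ≤ β·2·#Plaq`). [cite: Balaban1985Variational, Thm 1 (8) p.279] -/
theorem minimiserStabilityRegAt_of_eventually {F γ} (hγ : 0 ≤ γ) {b₀ p₀ m ε₀} (K₀ : ℕ) (r κ : ℕ → ℝ) (hr : Summable r)
    (hr0 : ∀ K, 0 ≤ r K)
    (h : ∀ K, K₀ ≤ K → ∀ (V : GaugeField (F.P (K / m)) 0 (Matrix.specialUnitaryGroup (Fin 2) ℂ)),
      PlaqSmall (θBal F.L γ b₀ p₀ (K / m)) V → |bgReg' F γ m ε₀ K V - bgReg F γ m ε₀ K V - κ K| ≤ r K) :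
    MinimiserStabilityRegAt F γ b₀ p₀ m ε₀ := by
  set B : ℕ → ℝ := fun K => (F.scheme ℰp γ).β (K + 1) * (2 * Fintype.card (Plaq (F.P (K + 1)) 0)) +
    (F.scheme ℰp γ).β K * (2 * Fintype.card (Plaq (F.P K) 0)) + |κ K| with hB
  have hB0 : ∀ K, 0 ≤ B K := fun K =>
    add_nonneg (add_nonneg (mul_nonneg (F.scheme_β_nonneg ℰp hγ _) (by positivity))
      (mul_nonneg (F.scheme_β_nonneg ℰp hγ _) (by positivity))) (abs_nonneg _)
  have hBbd : ∀ K (V : GaugeField (F.P (K / m)) 0 (Matrix.specialUnitaryGroup (Fin 2) ℂ)),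
      |bgReg' F γ m ε₀ K V - bgReg F γ m ε₀ K V - κ K| ≤ B K := by
    intro K V
    have hβ := F.scheme_β_nonneg ℰp hγ K
    have hβ' := F.scheme_β_nonneg ℰp hγ (K + 1)
    have ha0 := minActionReg_nonneg F ℰp (K := K + 1) (h := (Nat.div_le_self K m).trans (Nat.le_succ K)) (ε₀ := ε₀) V
    have ha1 := minActionReg_le_two_mul_card F ℰp (K := K + 1) ((Nat.div_le_self K m).trans (Nat.le_succ K)) ε₀ V
    have hb0' := minActionReg_nonneg F ℰp (K := K) (h := Nat.div_le_self K m) (ε₀ := ε₀) V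
    have hb1 := minActionReg_le_two_mul_card F ℰp (K := K) (Nat.div_le_self K m) ε₀ V
    have e1 := mul_le_mul_of_nonneg_left ha1 hβ'
    have e2 := mul_le_mul_of_nonneg_left hb1 hβ
    have e3 := mul_nonneg hβ' ha0
    have e4 := mul_nonneg hβ hb0'
    have k1 := neg_abs_le (κ K)
    have k2 := le_abs_self (κ K)
    show |(F.scheme ℰp γ).β (K + 1) * _ - (F.scheme ℰp γ).β K * _ - κ K| ≤
      (F.scheme ℰp γ).β (K + 1) * (2 * Fintype.card (Plaq (F.P (K + 1)) 0)) +
        (F.scheme ℰp γ).β K * (2 * Fintype.card (Plaq (F.P K) 0)) + |κ K|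
    refine abs_le.mpr ⟨?_, ?_⟩
    · linarith
    · linarith
  have hfin : Summable fun K => if K < K₀ then B K else 0 := by
    refine summable_of_ne_finset_zero (s := Finset.range K₀) fun K hK => ?_
    rw [Finset.mem_range] at hK
    exact if_neg hK
  refine ⟨fun K => r K + (if K < K₀ then B K else 0), κ, hr.add hfin, fun K => add_nonneg (hr0 K) ?_, fun K V hV => ?_⟩
  · by_cases hK : K < K₀
    · rw [if_pos hK]; exact hB0 K
    · rw [if_neg hK]
  · show _ ≤ r K + (if K < K₀ then B K else 0)
    by_cases hK : K < K₀
    · rw [if_pos hK]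
      linarith [hBbd K V, hr0 K]
    · rw [if_neg hK, add_zero]
      exact h K (not_lt.mp hK) V hV

/-- **EXISTENCE OF REGULAR CONSTRAINED MINIMISERS** (hypothesis schema, never asserted) — the tree's reading of [Balaban1985Variational]
Thm 1: from some `K₀` on, for every datum `V` on the comparison lattice with plaquettes within `θBal(⌊K/m⌋)` of `1`, the Wilson action
attains its minimum on the REGULAR fibres `regFibre` (plaquettes `< ε₀L^{−2(K−n)}`) of run `K` and of run `K+1`.  Printed for
`B₃·θBal ≤ ε₀ ≤ a₀` (constants depending on `d`, `L`), for the averaging of [Balaban1985Averaging]. [cite: Balaban1985Variational, Thm 1 (8) p.279] -/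
def HasRegMinimisersAt : Prop :=
  ∃ K₀ : ℕ, ∀ K, K₀ ≤ K → ∀ (V : GaugeField (F.P (K / m)) 0 (Matrix.specialUnitaryGroup (Fin 2) ℂ)),
    PlaqSmall (θBal F.L γ b₀ p₀ (K / m)) V →
      (∃ U ∈ regFibre F ℰp (K / m) K (Nat.div_le_self K m) ε₀ V,
          wilsonAction4 U = minActionReg F ℰp (K / m) K (Nat.div_le_self K m) ε₀ V) ∧
        ∃ U' ∈ regFibre F ℰp (K / m) (K + 1) ((Nat.div_le_self K m).trans (Nat.le_succ K)) ε₀ V,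
          wilsonAction4 U' = minActionReg F ℰp (K / m) (K + 1) ((Nat.div_le_self K m).trans (Nat.le_succ K)) ε₀ V

/-- **ONE-STEP UPPER BOUND ALONG REGULAR RUN-`K` MINIMISERS** (hypothesis schema, never asserted; INTERP along `U_k`): summable
`r_K ≥ 0` and `K₀` such that every regular minimiser `U` of run `K` over the regular fibre of a small `V` admits a REGULAR configuration
`U'` of run `K+1` in the regular fibre of `V` with `β_{K+1}A(U') ≤ β_K A(U) + r_K` (a one-step interpolation of a
`B₃ε₁L^{−2(K−n)}`-regular field is `≈ B₃ε₁L^{−2(K+1−n)}`-regular, [Balaban1985Variational] (9)–(10)). [cite: Balaban1985Variational, Thm 1 (8)-(10) p.279] -/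
def UpperAlongRegMinimisersAt : Prop :=
  ∃ (K₀ : ℕ) (r : ℕ → ℝ), Summable r ∧ (∀ K, 0 ≤ r K) ∧
    ∀ K, K₀ ≤ K → ∀ (V : GaugeField (F.P (K / m)) 0 (Matrix.specialUnitaryGroup (Fin 2) ℂ)),
      PlaqSmall (θBal F.L γ b₀ p₀ (K / m)) V →
        ∀ U ∈ regFibre F ℰp (K / m) K (Nat.div_le_self K m) ε₀ V,
          wilsonAction4 U = minActionReg F ℰp (K / m) K (Nat.div_le_self K m) ε₀ V →
            ∃ U' ∈ regFibre F ℰp (K / m) (K + 1) ((Nat.div_le_self K m).trans (Nat.le_succ K)) ε₀ V,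
              (F.scheme ℰp γ).β (K + 1) * wilsonAction4 U' ≤ (F.scheme ℰp γ).β K * wilsonAction4 U + r K

/-- **ONE-STEP LOWER BOUND ALONG REGULAR RUN-`(K+1)` MINIMISERS** (hypothesis schema, never asserted; AVG-INEQ along `U'_{k+1}`):
summable `r_K ≥ 0` and `K₀` such that every regular minimiser `U'` of run `K+1` admits a REGULAR configuration `U` of run `K` in the
regular fibre of `V` (its block average: [Balaban1985Averaging] Prop 2 (54), averages of regular fields are regular) with
`β_K A(U) ≤ β_{K+1}A(U') + r_K` ([Federbush1987PhaseCellIII] Thm 4.3 in kind). [cite: Federbush1987PhaseCellIII, Thm 4.3 (4.5) p.299] -/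
def LowerAlongRegMinimisersAt : Prop :=
  ∃ (K₀ : ℕ) (r : ℕ → ℝ), Summable r ∧ (∀ K, 0 ≤ r K) ∧
    ∀ K, K₀ ≤ K → ∀ (V : GaugeField (F.P (K / m)) 0 (Matrix.specialUnitaryGroup (Fin 2) ℂ)),
      PlaqSmall (θBal F.L γ b₀ p₀ (K / m)) V →
        ∀ U' ∈ regFibre F ℰp (K / m) (K + 1) ((Nat.div_le_self K m).trans (Nat.le_succ K)) ε₀ V,
          wilsonAction4 U' = minActionReg F ℰp (K / m) (K + 1) ((Nat.div_le_self K m).trans (Nat.le_succ K)) ε₀ V →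
            ∃ U ∈ regFibre F ℰp (K / m) K (Nat.div_le_self K m) ε₀ V,
              (F.scheme ℰp γ).β K * wilsonAction4 U ≤ (F.scheme ℰp γ).β (K + 1) * wilsonAction4 U' + r K

variable {F γ b₀ p₀ m ε₀}

/-- **THE REDUCTION AT THE REGULAR BACKGROUND** (`γ ≥ 0`): the three schemas ⇒ `MinimiserStabilityRegAt F γ b₀ p₀ m ε₀` (κ ≡ 0, radii
`r + r'` from the larger `K₀` on). [cite: King1986, App. (A.5) p.676] -/
theorem minimiserStabilityRegAt_of_alongRegMinimisers (hγ : 0 ≤ γ) (hex : HasRegMinimisersAt F γ b₀ p₀ m ε₀)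
    (hup : UpperAlongRegMinimisersAt F γ b₀ p₀ m ε₀) (hlow : LowerAlongRegMinimisersAt F γ b₀ p₀ m ε₀) :
    MinimiserStabilityRegAt F γ b₀ p₀ m ε₀ := by
  obtain ⟨K₁, hex⟩ := hex
  obtain ⟨K₂, r, hr, hr0, hup⟩ := hup
  obtain ⟨K₃, r', hr', hr0', hlow⟩ := hlow
  refine minimiserStabilityRegAt_of_eventually hγ (max K₁ (max K₂ K₃)) (fun K => r K + r' K) (fun _ => 0)
    (hr.add hr') (fun K => add_nonneg (hr0 K) (hr0' K)) fun K hK V hV => ?_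
  have hK₁ : K₁ ≤ K := (le_max_left _ _).trans hK
  have hK₂ : K₂ ≤ K := ((le_max_left _ _).trans (le_max_right _ _)).trans hK
  have hK₃ : K₃ ≤ K := ((le_max_right _ _).trans (le_max_right _ _)).trans hK
  obtain ⟨⟨U, hU, hUmin⟩, ⟨U', hU', hU'min⟩⟩ := hex K hK₁ V hV
  obtain ⟨W', hW', hupW⟩ := hup K hK₂ V hV U hU hUmin
  obtain ⟨W, hW, hlowW⟩ := hlow K hK₃ V hV U' hU' hU'min
  have hβ := F.scheme_β_nonneg ℰp hγ K
  have hβ' := F.scheme_β_nonneg ℰp hγ (K + 1)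
  have h1 : bgReg' F γ m ε₀ K V ≤ bgReg F γ m ε₀ K V + r K := by
    show (F.scheme ℰp γ).β (K + 1) * _ ≤ (F.scheme ℰp γ).β K * _ + r K
    rw [← hUmin]
    exact (mul_le_mul_of_nonneg_left (minActionReg_le F ℰp hW') hβ').trans hupW
  have h2 : bgReg F γ m ε₀ K V ≤ bgReg' F γ m ε₀ K V + r' K := by
    show (F.scheme ℰp γ).β K * _ ≤ (F.scheme ℰp γ).β (K + 1) * _ + r' K
    rw [← hU'min]
    exact (mul_le_mul_of_nonneg_left (minActionReg_le F ℰp hW) hβ).trans hlowW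
  have := hr0 K
  have := hr0' K
  rw [sub_zero]
  exact abs_le.mpr ⟨by linarith, by linarith⟩

/-- All the way to K1's body at the regular background: the three schemas ∧ `FluctuationComparisonRegAt` ⇒ `UnitTiltAt F γ b₀ p₀ m`.
[cite: King1986, Thm 3.4 (3.9) p.656] -/
theorem unitTiltAt_of_alongRegMinimisers_fluctuationReg (hγ : 0 ≤ γ) (hex : HasRegMinimisersAt F γ b₀ p₀ m ε₀)
    (hup : UpperAlongRegMinimisersAt F γ b₀ p₀ m ε₀) (hlow : LowerAlongRegMinimisersAt F γ b₀ p₀ m ε₀)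
    (hfl : FluctuationComparisonRegAt F γ b₀ p₀ m ε₀) : UnitTiltAt F γ b₀ p₀ m :=
  unitTiltAt_of_reg hγ (minimiserStabilityRegAt_of_alongRegMinimisers hγ hex hup hlow) hfl

end Reduction

end Literature.MathematicalPhysics.QuantumFieldTheory.Balaban1983to89.T3RegularMinimiserReduction

end
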